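import Literature.AnabelianGeometry.SemiGraphs.SubdivisionPaths
import Literature.AnabelianGeometry.SemiGraphs.FreeGroupsAndActionsProofs2
import HarnessLib

/-!
# Fixed loci over a semi-graph whose fixed stars have a single branch type BOUNCE over one closed edge

Mochizuki, *Semi-graphs of anabelioids*, Publ. RIMS **42** (2006) [MochizukiSemiAnbd2006], §1 pp. 11–13
(semi-graphs, morphisms, the barycentric subdivision, trees), Lemma 1.8 (ii)(b) p. 20 ("if `Γ` fixes two
distinct vertices … then `Γ` acts trivially on any geodesic that joins [them]"), and the sub-joint argument
in the proof of Theorem 3.7 (iii) p. 41 [cite: MochizukiSemiAnbd2006, Thm 3.7(iii) p.41].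

PROOF-ONLY tool file (abc-iut cell, layer L3, G2 characterisation lane; seat abc-iut-L3-t8 gen 5, memo
HOME/staging/L3/L3-t8/g5/G2-CHARACTERISATION-L3t8g5.md (C1); no definition, nothing specific to
anabelioids).  Setting: a TREE `T` over a semi-graph `𝔾` (`π : T ⟶ 𝔾`), a family `S` of automorphisms of `T`
(in the application: the level action of a compact subgroup of `π₁^temp`), a vertex `v` of `𝔾`, and the
hypothesis (the output of `TemperedFixedEdgesParallel.lean`) that at every `S`-fixed-relevant vertex of `T`
over `v` OR OVER A NEIGHBOUR of `v`, any two `S`-fixed branches lie over the same branch of `𝔾`.  Then: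

* `SemiGraph.path_inl_segment` — the shape `z – c – e – c' – z'` of a path between vertex-points at every
  vertex-point position (the tree's `path_inl_prefix` at an arbitrary offset);
* `SemiGraph.exists_base_eq_or_eq_of_fixed` — **BOUNCE**: if `x` over `v` is `S`-fixed, there is ONE vertex
  `u` of `𝔾` (an endpoint of the edge under the fixed star of `x`, or `v`) such that EVERY `S`-fixed vertex
  of `T` lies over `v` or over `u`: the `S`-fixed geodesic from `x` (Lemma 1.8 (ii)(b),
  `nodeMap_eq_self_of_isPath`) alternates over the two ends of a single closed edge of `𝔾`.

Consumer: the tempered corollary «persistent base vertex ⇒ the base images of the fixed loci are eventually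
contained in one closed edge» (`TemperedFixedLocusBounce.lean`).  Nothing here bears on [IUTchIII] Cor. 3.12.
-/

namespace Literature.AnabelianGeometry.SemiGraphs

namespace SemiGraph

open CategoryTheory

universe u

variable {G : SemiGraph.{u}}

/-! ### The shape of a path between vertex-points at an arbitrary vertex position -/

/-- **Segments of a path between vertex-points.**  If a path of the subdivision from a vertex-point to a
vertex-point `Sum.inl w` sits at a vertex `z` at position `i < length`, then positions `i+1 … i+4` read
`c – e – c' – z'` with `c ≠ c'` the two branches of `e`, `c` abutting to `z` and `c'` to `z'` (so
`i + 4 ≤ length`). [cite: MochizukiSemiAnbd2006, §1 pp.11-13] -/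
theorem path_inl_segment {x : G.Node} {w : G.Vertex} (p : G.subdivision.Walk x (Sum.inl w)) (hp : p.IsPath)
    {i : ℕ} (hi : i < p.length) {z : G.Vertex} (hz : p.getVert i = Sum.inl z) :
    i + 4 ≤ p.length ∧ ∃ (c c' : G.Branch) (e : G.Edge) (z' : G.Vertex), c ≠ c' ∧
      G.edgeOf c = e ∧ G.edgeOf c' = e ∧ G.abuts c = some z ∧ G.abuts c' = some z' ∧
      p.getVert (i + 1) = Sum.inr (Sum.inr c) ∧ p.getVert (i + 2) = Sum.inr (Sum.inl e) ∧
      p.getVert (i + 3) = Sum.inr (Sum.inr c') ∧ p.getVert (i + 4) = Sum.inl z' := by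
  obtain ⟨c, hcz, hx1⟩ := step_vertex p hi hz
  have h1 : i + 1 < p.length := lt_length_of_getVert_ne p (by omega) (by rw [hx1]; simp)
  have hx2 : p.getVert (i + 2) = Sum.inr (Sum.inl (G.edgeOf c)) := by
    rcases step_branch p h1 hx1 with h | ⟨v, hv, h⟩
    · exact h
    · exfalso
      have hvz : v = z := by rw [hcz] at hv; simpa using hv.symm
      exact getVert_add_two_ne p hp (i := i) (by omega) (by rw [h, hz, hvz])
  have h2 : i + 2 < p.length := lt_length_of_getVert_ne p (by omega) (by rw [hx2]; simp)
  obtain ⟨c', hc'e, hx3⟩ := step_edge p h2 hx2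
  have hcc : c' ≠ c := fun h =>
    getVert_add_two_ne p hp (i := i + 1) (by omega) (by rw [show i + 1 + 2 = i + 3 by omega, hx3, hx1, h])
  have h3 : i + 3 < p.length := lt_length_of_getVert_ne p (by omega) (by rw [hx3]; simp)
  obtain ⟨z', hc'z, hx4⟩ : ∃ z' : G.Vertex, G.abuts c' = some z' ∧ p.getVert (i + 4) = Sum.inl z' := by
    rcases step_branch p h3 hx3 with h | h
    · exfalso
      exact getVert_add_two_ne p hp (i := i + 2) (by omega)
        (by rw [show i + 2 + 2 = i + 4 by omega, h, hx2, hc'e])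
    · exact h
  exact ⟨by omega, c, c', G.edgeOf c, z', fun h => hcc h.symm, rfl, hc'e, hcz, hc'z, hx1, hx2, hx3, hx4⟩

/-! ### Bounce -/

variable {𝔾 : SemiGraph.{u}}

/-- **BOUNCE.**  Let `T` be a tree over `𝔾` (`π : T ⟶ 𝔾`), `S` a family of automorphisms of `T`, `v` a vertex
of `𝔾`, and suppose that at every vertex `z` of `T` lying over `v` or over a vertex joined to `v` by an edge,
any two `S`-fixed branches of `T` abutting to `z` lie over the same branch of `𝔾`.  If `x` over `v` is
`S`-fixed, then there is a vertex `u` of `𝔾` such that every `S`-fixed vertex of `T` lies over `v` or over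
`u`: the fixed locus "bounces" over one closed edge.  (The `S`-fixed geodesic `x = z₀ – z₁ – ⋯ – z_k = y`,
Lemma 1.8 (ii)(b): at each `z_j` the incoming and outgoing branches are fixed, hence of the same type, so
consecutive edges lie over the same edge of `𝔾` and `π z_{j+2} = π z_j`.)
[cite: MochizukiSemiAnbd2006, Thm 3.7(iii) p.41] -/
theorem exists_base_eq_or_eq_of_fixed {T : SemiGraph.{u}} (hT : T.IsTree) (π : T ⟶ 𝔾) (S : Set (Aut T))
    (v : 𝔾.Vertex)
    (hsame : ∀ z : T.Vertex, (π.vertexMap z = v ∨ ∃ b b' : 𝔾.Branch, b ≠ b' ∧ 𝔾.edgeOf b = 𝔾.edgeOf b' ∧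
        𝔾.abuts b = some v ∧ 𝔾.abuts b' = some (π.vertexMap z)) →
      ∀ β β' : T.Branch, T.abuts β = some z → T.abuts β' = some z →
        (∀ σ ∈ S, σ.hom.branchMap β = β) → (∀ σ ∈ S, σ.hom.branchMap β' = β') →
        π.branchMap β = π.branchMap β')
    (x : T.Vertex) (hx : π.vertexMap x = v) (hfx : ∀ σ ∈ S, σ.hom.vertexMap x = x) :
    ∃ u : 𝔾.Vertex, ∀ y : T.Vertex, (∀ σ ∈ S, σ.hom.vertexMap y = y) →
      π.vertexMap y = v ∨ π.vertexMap y = u := by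
  classical
  have hA : T.subdivision.IsAcyclic := hT.isTree.isAcyclic
  -- an `S`-fixed path from `x` to a fixed `y` is fixed node-wise (Lemma 1.8 (ii)(b))
  have hpathfix : ∀ (y : T.Vertex), (∀ σ ∈ S, σ.hom.vertexMap y = y) →
      ∀ (p : T.subdivision.Walk (Sum.inl x) (Sum.inl y)), p.IsPath →
        ∀ (i : ℕ) (β : T.Branch), p.getVert i = Sum.inr (Sum.inr β) → ∀ σ ∈ S, σ.hom.branchMap β = β := by
    intro y hy p hp i β hi σ hσ
    have h := nodeMap_eq_self_of_isPath hA σ (x := Sum.inl x) (y := Sum.inl y)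
      (by rw [nodeMap_inl, hfx σ hσ]) (by rw [nodeMap_inl, hy σ hσ]) p hp _ (p.getVert_mem_support i)
    rw [hi, nodeMap_inr_inr] at h
    simpa using h
  by_cases hβ₀ : ∃ β₀ : T.Branch, T.abuts β₀ = some x ∧ ∀ σ ∈ S, σ.hom.branchMap β₀ = β₀
  · obtain ⟨β₀, hβ₀x, hβ₀fix⟩ := hβ₀
    -- the type `t₀` of the fixed star of `x`, its edge, the opposite branch `t₁` and its vertex `u`
    set t₀ := π.branchMap β₀ with ht₀
    have ht₀v : 𝔾.abuts t₀ = some v := by rw [← hx]; exact π.abuts_branchMap β₀ x hβ₀x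
    obtain ⟨b₁, b₂, hb₁₂, hb₁, hb₂, hall⟩ := 𝔾.two_branches (𝔾.edgeOf t₀)
    let t₁ : 𝔾.Branch := if t₀ = b₁ then b₂ else b₁
    have ht₁e : 𝔾.edgeOf t₁ = 𝔾.edgeOf t₀ := by
      by_cases h : t₀ = b₁ <;> simp only [t₁, h, if_true, if_false, hb₁, hb₂]
    have ht₁ne : t₁ ≠ t₀ := by
      by_cases h : t₀ = b₁
      · simp only [t₁, h, if_true]; exact fun h' => hb₁₂ h'.symm
      · simp only [t₁, h, if_false]; exact fun h' => h h'.symm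
    -- the other branch of the edge of `t₀`: anything `≠ t₀` over that edge is `t₁`, and vice versa
    have hother : ∀ b : 𝔾.Branch, 𝔾.edgeOf b = 𝔾.edgeOf t₀ → b ≠ t₀ → b = t₁ := by
      intro b hb hbt
      rcases hall b hb with hb' | hb'
      · by_cases h : t₀ = b₁
        · exact absurd (hb'.trans h.symm) hbt
        · rw [hb']; simp only [t₁, h, if_false]
      · by_cases h : t₀ = b₁
        · rw [hb']; simp only [t₁, h, if_true]
        · rcases hall t₀ rfl with h' | h'
          · exact absurd h' h
          · exact absurd (hb'.trans h'.symm) hbt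
    have hother' : ∀ b : 𝔾.Branch, 𝔾.edgeOf b = 𝔾.edgeOf t₀ → b ≠ t₁ → b = t₀ := by
      intro b hb hbt
      by_contra h
      exact hbt (hother b hb h)
    let u : 𝔾.Vertex := (𝔾.abuts t₁).getD v
    refine ⟨u, fun y hy => ?_⟩
    by_cases hxy : x = y
    · left; rw [← hxy, hx]
    -- the fixed geodesic from `x` to `y`
    obtain ⟨q⟩ := hT.isTree.connected (Sum.inl x : T.Node) (Sum.inl y)
    let p : T.subdivision.Walk (Sum.inl x) (Sum.inl y) := q.bypass
    have hp : p.IsPath := q.bypass_isPath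
    have hfixbr := hpathfix y hy p hp
    /- invariant along the path: at position `4k` a vertex over `v` followed by a branch of type `t₀`, or a
    vertex over `u` followed by a branch of type `t₁` -/
    have key : ∀ k : ℕ, 4 * k ≤ p.length → ∃ z : T.Vertex, p.getVert (4 * k) = Sum.inl z ∧
        ((π.vertexMap z = v ∧ (4 * k < p.length → ∃ c : T.Branch,
            p.getVert (4 * k + 1) = Sum.inr (Sum.inr c) ∧ T.abuts c = some z ∧ π.branchMap c = t₀)) ∨
         (π.vertexMap z = u ∧ (4 * k < p.length → ∃ c : T.Branch,
            p.getVert (4 * k + 1) = Sum.inr (Sum.inr c) ∧ T.abuts c = some z ∧ π.branchMap c = t₁))) := by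
      intro k
      induction k with
      | zero =>
        intro _
        refine ⟨x, by simp, Or.inl ⟨hx, fun h0 => ?_⟩⟩
        obtain ⟨c, hcx, hc1⟩ := step_vertex p (i := 0) h0 p.getVert_zero
        refine ⟨c, hc1, hcx, ?_⟩
        exact hsame x (Or.inl hx) c β₀ hcx hβ₀x (hfixbr 1 c hc1) hβ₀fix
      | succ k ih =>
        intro hk
        obtain ⟨z, hz, hcase⟩ := ih (by omega)
        have hlt : 4 * k < p.length := by omega
        obtain ⟨-, c, c', e, z', hcc', hce, hc'e, hcz, hc'z', h1, h2, h3, h4⟩ :=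
          path_inl_segment p hp hlt hz
        have h4' : p.getVert (4 * (k + 1)) = Sum.inl z' := by rw [show 4 * (k + 1) = 4 * k + 4 by ring]; exact h4
        -- the images of `c ≠ c'` are the two distinct branches of `π e`
        have hπcc' : π.branchMap c ≠ π.branchMap c' := fun h =>
          hcc' (π.branchMap_injOn c c' (by rw [hce, hc'e]) h)
        have hπe : 𝔾.edgeOf (π.branchMap c') = 𝔾.edgeOf (π.branchMap c) := by
          rw [π.edgeOf_branchMap, π.edgeOf_branchMap, hce, hc'e]
        have hπz' : 𝔾.abuts (π.branchMap c') = some (π.vertexMap z') := π.abuts_branchMap c' z' hc'z'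
        -- the next outgoing branch (if any) has the type of the incoming one `c'`
        have hnext : 4 * (k + 1) < p.length →
            (π.vertexMap z' = v ∨ ∃ b b' : 𝔾.Branch, b ≠ b' ∧ 𝔾.edgeOf b = 𝔾.edgeOf b' ∧
              𝔾.abuts b = some v ∧ 𝔾.abuts b' = some (π.vertexMap z')) →
            ∃ c'' : T.Branch, p.getVert (4 * (k + 1) + 1) = Sum.inr (Sum.inr c'') ∧
              T.abuts c'' = some z' ∧ π.branchMap c'' = π.branchMap c' := by
          intro hlt' hz'
          obtain ⟨c'', hc''z, hc''1⟩ := step_vertex p hlt' h4'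
          refine ⟨c'', hc''1, hc''z, ?_⟩
          refine hsame z' hz' c'' c' hc''z hc'z' (hfixbr _ c'' hc''1) (hfixbr (4 * k + 3) c' h3)
        refine ⟨z', h4', ?_⟩
        rcases hcase with ⟨hzv, hc⟩ | ⟨hzu, hc⟩
        · -- `z` over `v`, outgoing type `t₀`: then `c'` has type `t₁` and `z'` lies over `u`
          obtain ⟨c₀, hc₀1, -, hc₀t⟩ := hc hlt
          have hcc₀ : c = c₀ := by
            have := h1.symm.trans hc₀1
            simpa using this
          have hct₀ : π.branchMap c = t₀ := by rw [hcc₀, hc₀t]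
          have hc't₁ : π.branchMap c' = t₁ :=
            hother _ (by rw [hπe, hct₀]) (by rw [← hct₀]; exact fun h => hπcc' h.symm)
          have hz'u : π.vertexMap z' = u := by
            have h := hπz'
            rw [hc't₁] at h
            simp only [u, h, Option.getD_some]
          right
          refine ⟨hz'u, fun hlt' => ?_⟩
          have hz't : 𝔾.abuts t₁ = some (π.vertexMap z') := hc't₁ ▸ hπz'
          obtain ⟨c'', hc''1, hc''z, hc''t⟩ :=
            hnext hlt' (Or.inr ⟨t₀, t₁, ht₁ne.symm, ht₁e.symm, ht₀v, hz't⟩)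
          exact ⟨c'', hc''1, hc''z, hc''t.trans hc't₁⟩
        · -- `z` over `u`, outgoing type `t₁`: then `c'` has type `t₀` and `z'` lies over `v`
          obtain ⟨c₀, hc₀1, -, hc₀t⟩ := hc hlt
          have hcc₀ : c = c₀ := by
            have := h1.symm.trans hc₀1
            simpa using this
          have hct₁ : π.branchMap c = t₁ := by rw [hcc₀, hc₀t]
          have hc't₀ : π.branchMap c' = t₀ :=
            hother' _ (by rw [hπe, hct₁, ht₁e]) (by rw [← hct₁]; exact fun h => hπcc' h.symm)
          have hz'v : π.vertexMap z' = v := by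
            have h := hπz'
            rw [hc't₀, ht₀v] at h
            exact (Option.some.inj h).symm
          left
          refine ⟨hz'v, fun hlt' => ?_⟩
          obtain ⟨c'', hc''1, hc''z, hc''t⟩ := hnext hlt' (Or.inl hz'v)
          exact ⟨c'', hc''1, hc''z, hc''t.trans hc't₀⟩
    -- the endpoint `y` sits at position `length = 4k`
    have hlen : 4 * (p.length / 4) = p.length := by
      obtain ⟨z, hz, -⟩ := key (p.length / 4) (Nat.mul_div_le _ _)
      by_contra hne
      have hlt : 4 * (p.length / 4) < p.length := lt_of_le_of_ne (Nat.mul_div_le _ _) hne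
      have h := (path_inl_segment p hp hlt hz).1
      omega
    obtain ⟨z, hz, hcase⟩ := key (p.length / 4) (Nat.mul_div_le _ _)
    rw [hlen, p.getVert_length] at hz
    have hzy : z = y := by simpa using hz.symm
    subst hzy
    rcases hcase with ⟨h, -⟩ | ⟨h, -⟩
    · exact Or.inl h
    · exact Or.inr h
  · -- no fixed branch at `x`: then `x` is the only fixed vertex
    refine ⟨v, fun y hy => Or.inl ?_⟩
    by_cases hxy : x = y
    · rw [← hxy, hx]
    · exfalso
      obtain ⟨q⟩ := hT.isTree.connected (Sum.inl x : T.Node) (Sum.inl y)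
      let p : T.subdivision.Walk (Sum.inl x) (Sum.inl y) := q.bypass
      have hp : p.IsPath := q.bypass_isPath
      have h0 : 0 < p.length := lt_length_of_getVert_ne p (Nat.zero_le _)
        (by rw [p.getVert_zero]; simpa using hxy)
      obtain ⟨c, hcx, hc1⟩ := step_vertex p (i := 0) h0 p.getVert_zero
      exact hβ₀ ⟨c, hcx, hpathfix y hy p hp 1 c hc1⟩

/-! ### The second base vertex is a neighbour -/

/-- On a path between vertex-points, every position `4k ≤ length` carries a vertex-point.
[cite: MochizukiSemiAnbd2006, §1 pp.11-13] -/
theorem exists_getVert_four_mul_eq_inl {x w : G.Vertex} (p : G.subdivision.Walk (Sum.inl x) (Sum.inl w))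
    (hp : p.IsPath) (k : ℕ) (hk : 4 * k ≤ p.length) : ∃ z : G.Vertex, p.getVert (4 * k) = Sum.inl z := by
  induction k with
  | zero => exact ⟨x, by simp⟩
  | succ k ih =>
    obtain ⟨z, hz⟩ := ih (by omega)
    obtain ⟨-, c, c', e, z', -, -, -, -, -, -, -, -, h4⟩ := path_inl_segment p hp (by omega) hz
    exact ⟨z', by rw [show 4 * (k + 1) = 4 * k + 4 by ring]; exact h4⟩

/-- **BOUNCE, with the second base vertex located**: under the hypotheses of
`exists_base_eq_or_eq_of_fixed`, the vertex `u` may be taken to be `v` itself or JOINED TO `v` BY AN EDGE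
of `𝔾` — every `S`-fixed vertex of the tree lies over one closed edge at `v` (or over `v`).  (If some fixed
vertex lies over `u ≠ v`, the fixed geodesic to it first leaves the fibre over `v` across a tree edge,
whose image joins `v` to `u`.) [cite: MochizukiSemiAnbd2006, Thm 3.7(iii) p.41] -/
theorem exists_base_eq_or_adj_of_fixed {T : SemiGraph.{u}} (hT : T.IsTree) (π : T ⟶ 𝔾) (S : Set (Aut T))
    (v : 𝔾.Vertex)
    (hsame : ∀ z : T.Vertex, (π.vertexMap z = v ∨ ∃ b b' : 𝔾.Branch, b ≠ b' ∧ 𝔾.edgeOf b = 𝔾.edgeOf b' ∧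
        𝔾.abuts b = some v ∧ 𝔾.abuts b' = some (π.vertexMap z)) →
      ∀ β β' : T.Branch, T.abuts β = some z → T.abuts β' = some z →
        (∀ σ ∈ S, σ.hom.branchMap β = β) → (∀ σ ∈ S, σ.hom.branchMap β' = β') →
        π.branchMap β = π.branchMap β')
    (x : T.Vertex) (hx : π.vertexMap x = v) (hfx : ∀ σ ∈ S, σ.hom.vertexMap x = x) :
    ∃ u : 𝔾.Vertex, (u = v ∨ ∃ b b' : 𝔾.Branch, b ≠ b' ∧ 𝔾.edgeOf b = 𝔾.edgeOf b' ∧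
        𝔾.abuts b = some v ∧ 𝔾.abuts b' = some u) ∧
      ∀ y : T.Vertex, (∀ σ ∈ S, σ.hom.vertexMap y = y) → π.vertexMap y = v ∨ π.vertexMap y = u := by
  classical
  obtain ⟨u, hu⟩ := exists_base_eq_or_eq_of_fixed hT π S v hsame x hx hfx
  by_cases hfar : ∃ y : T.Vertex, (∀ σ ∈ S, σ.hom.vertexMap y = y) ∧ π.vertexMap y ≠ v
  · obtain ⟨y, hy, hyv⟩ := hfar
    have hA : T.subdivision.IsAcyclic := hT.isTree.isAcyclic
    obtain ⟨q⟩ := hT.isTree.connected (Sum.inl x : T.Node) (Sum.inl y)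
    let p : T.subdivision.Walk (Sum.inl x) (Sum.inl y) := q.bypass
    have hp : p.IsPath := q.bypass_isPath
    -- every node of the fixed geodesic is fixed
    have hnode : ∀ (i : ℕ) (σ : Aut T), σ ∈ S → nodeMap σ (p.getVert i) = p.getVert i := fun i σ hσ =>
      nodeMap_eq_self_of_isPath hA σ (x := Sum.inl x) (y := Sum.inl y)
        (by rw [nodeMap_inl, hfx σ hσ]) (by rw [nodeMap_inl, hy σ hσ]) p hp _ (p.getVert_mem_support i)
    -- the first vertex position whose base is not `v`
    have hlen : ∃ k, 4 * k ≤ p.length ∧ ∀ z : T.Vertex, p.getVert (4 * k) = Sum.inl z → π.vertexMap z ≠ v := by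
      refine ⟨p.length / 4, Nat.mul_div_le _ _, fun z hz => ?_⟩
      -- the endpoint: `4 * (length / 4) = length` (positions advance by `4`)
      have h4 : 4 * (p.length / 4) = p.length := by
        by_contra hne
        have hlt : 4 * (p.length / 4) < p.length := lt_of_le_of_ne (Nat.mul_div_le _ _) hne
        have h := (path_inl_segment p hp hlt hz).1
        omega
      rw [h4, p.getVert_length] at hz
      have : z = y := by simpa using hz.symm
      rw [this]; exact hyv
    let k₀ := Nat.find hlen
    obtain ⟨hk₀, hk₀v⟩ := Nat.find_spec hlen
    have hk₀pos : 0 < k₀ := by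
      by_contra h0
      have hk : k₀ = 0 := by omega
      have h := hk₀v x (by rw [show 4 * k₀ = 0 by omega]; simp)
      exact h hx
    -- the previous vertex position `4 (k₀ - 1)` has base `v`
    obtain ⟨z₁, hz₁⟩ := exists_getVert_four_mul_eq_inl p hp (k₀ - 1) (by omega)
    have hz₁v : π.vertexMap z₁ = v := by
      by_contra hne
      have hmin := Nat.find_min hlen (show k₀ - 1 < k₀ by omega)
      exact hmin ⟨by omega, fun z hz => by
        have : z = z₁ := by rw [hz₁] at hz; simpa using hz.symm
        rw [this]; exact hne⟩
    have hlt : 4 * (k₀ - 1) < p.length := by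
      by_contra hge
      have heq : 4 * (k₀ - 1) = p.length := by omega
      rw [heq, p.getVert_length] at hz₁
      have : y = z₁ := by simpa using hz₁
      exact hyv (this ▸ hz₁v)
    obtain ⟨-, c, c', e, z₂, hcc', hce, hc'e, hcz₁, hc'z₂, -, -, -, h4⟩ := path_inl_segment p hp hlt hz₁
    have hz₂ : p.getVert (4 * k₀) = Sum.inl z₂ := by
      rw [show 4 * k₀ = 4 * (k₀ - 1) + 4 by omega]; exact h4
    have hz₂v : π.vertexMap z₂ ≠ v := hk₀v z₂ hz₂
    -- `z₂` is fixed, hence over `u`; the edge `e` joins `v` to `u`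
    have hfz₂ : ∀ σ ∈ S, σ.hom.vertexMap z₂ = z₂ := by
      intro σ hσ
      have h := hnode (4 * k₀) σ hσ
      rw [hz₂, nodeMap_inl] at h
      simpa using h
    have hz₂u : π.vertexMap z₂ = u := (hu z₂ hfz₂).resolve_left hz₂v
    refine ⟨u, Or.inr ⟨π.branchMap c, π.branchMap c', ?_, ?_, ?_, ?_⟩, hu⟩
    · exact fun h => hcc' (π.branchMap_injOn c c' (by rw [hce, hc'e]) h)
    · rw [π.edgeOf_branchMap, π.edgeOf_branchMap, hce, hc'e]
    · rw [← hz₁v]; exact π.abuts_branchMap c z₁ hcz₁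
    · rw [← hz₂u]; exact π.abuts_branchMap c' z₂ hc'z₂
  · push Not at hfar
    exact ⟨v, Or.inl rfl, fun y hy => Or.inl (hfar y hy)⟩

end SemiGraph

end Literature.AnabelianGeometry.SemiGraphs
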